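import Summits.HodgeConjecture.CorCM.HCCMCodimensionTwoOneVariety
import Summits.HodgeConjecture.CorCM.CMProductSimpleFactors
import HarnessLib

/-!
# The slice of `HC_CM` at ONE Galois CM field `F` is decided in codimension two: by the face Weil lines of `F`, by the
# `(2,2)`-classes on the four-realisation products over `F`, by the `(2,2)`-classes on `P_F⁴`

COR-CM (cell `pub-hodgecm2`), seat b24, count-neutral lane SLICE-EXHAUSTION, part 6 (theorems only, no definition, no named
fact).  Parts 3–5 are GLOBAL (`HC_CM ⟺ …`).  The face reduction of the model universe is itself FIELD BY FIELD
(`Universe.FaceReduction`: for a Galois CM field `F` with `[F:ℚ] ≥ 6`, the face Weil lines OF `F` give `U.HC` of every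
`∏_j A_{(F,Θ_j)}`), so the same equivalences hold slice by slice — which is the form the per-field lanes of the cell consume
(degree `≤ 4`: nothing to do; `ℚ(ζ₇)`, `ℚ(ζ₉)`, Galois sextic …: the slice is decided by `(2,2)`-classes on `12`-folds):

for a CM field `F`, GALOIS over `ℚ` with `6 ≤ [F:ℚ]`, and the model universe `U = Model.universeOf hHD hI hU h₃`,
* `forall_cmProdAV_iff_forall_weilFaceAlgebraic` — `(∀ n Θ, HodgeConjectureFor (cmProdAV F h₃ n Θ)) ⟺ ∀ f : Face F,
  U.WeilFaceAlgebraic ⟨F⟩ f` (⟸: `Model.hc_cmProd_of_weilFaceAlgebraic_of_riemann` at `deligneMilne1982_Thm_6_20_full_holds`;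
  ⟹: `Model.universeOf_fact_weilLine_hodge`);
* `weilFaceAlgebraic_of_codimTwo_cmProdAV` — codimension-two HC on `∏_i A_{(F, f.corner i)}` gives `U.WeilFaceAlgebraic ⟨F⟩ f`;
* **`forall_cmProdAV_iff_codimTwo_cmProdAV_three`** — the slice at `F` ⟺ the rational `(2,2)`-classes on every
  `∏_{j<4} A_{(F,Θ_j)}` are algebraic;
* **`forall_cmProdAV_iff_codimTwo_powSucc_three`** — the slice at `F` ⟺ the rational `(2,2)`-classes on `P_F⁴ =
  (cmProdAV F h₃ N Θ₀).powSucc 3` are algebraic (`Θ₀` any enumeration of `CMType F`);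
* **`binderSlice_iff_codimTwo_cmProdAV_three`** — the same for the binder-language slice (part 2, at `cmAbelianVarietyRealised_holds`).

Nothing is asserted; every statement is an equivalence between unproved propositions (or an implication between them).

## References
* [Pohlmann1968] H. Pohlmann, Ann. of Math. 88 (1968), Thm. 1.
* [Andre1992HodgeCM] Y. André, Progr. Math. 102 (1992), Théorème pp. 4–5.
* [Milne2020HodgeClassesAV] J. S. Milne, *Hodge classes on abelian varieties* (2020), Theorem 1.
* [Deligne1982HodgeCycles] P. Deligne, LNM 900 (1982), §4–§5.
* [MumfordAV1970] D. Mumford, *Abelian Varieties* (1970), §19.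
-/

noncomputable section

open CategoryTheory NumberField AlgebraicGeometry
open Literature.AlgebraicGeometry Literature.AlgebraicGeometry.Motives Literature.AlgebraicGeometry.HodgeTheory
open Literature.AlgebraicGeometry.ComplexMultiplication Literature.AlgebraicGeometry.Milne1999
open Literature.NumberTheory.Automorphic
open Literature.NumberTheory.Automorphic.PicardCM (BallQuotientUniformisedDatum CMAbelianVarietyRealised
  BallQuotientUniformised ballQuotientUniformisedDatum_of)
open Literature.NumberTheory.ComplexMultiplication.CMTypeOps (bar)
open Literature.NumberTheory.Automorphic.PicardCM.CMCode (cmTypeMap)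
open Summit.HodgeConjecture.CorCM.Domination
open Summit.HodgeConjecture.CorCM.Model

namespace Summit.HodgeConjecture.CorCM.SliceExhaustion

variable {F : Type} [Field F] [NumberField F] [IsCMField F]

/-! ## §1 The slice at `F` ⟺ the face Weil lines of `F` -/

/-- **Face reduction, one field**: if every face Weil line `W_F(P(f))` of `F` (Galois, `6 ≤ [F:ℚ]`) is algebraic in the model
universe, then `HodgeConjectureFor (∏_j A_{(F,Θ_j)})` for every family `Θ` (`Model.hc_cmProd_of_weilFaceAlgebraic_of_riemann`
at the tree theorem `deligneMilne1982_Thm_6_20_full_holds`, read on the tree's abelian variety by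
`universeOf_hc_cmProd_iff_hodgeConjectureFor_cmProdAV`). [cite: Pohlmann1968, Thm. 1] [cite: Milne2020HodgeClassesAV, Theorem 1] -/
theorem forall_cmProdAV_of_forall_weilFaceAlgebraic (hHD : exists_isReal_hodgeModel)
    (hI : hodgePQ_independent_of_hodgeModel) (hU : BallQuotientUniformisedDatum) (h₃ : CMAbelianVarietyRealised)
    (hG : IsGalois ℚ F) (h6 : 6 ≤ Module.finrank ℚ F)
    (hfaces : ∀ f : Face F, (universeOf hHD hI hU h₃).WeilFaceAlgebraic (CMField.mk F) f)
    (n : ℕ) (Θ : Fin (n + 1) → CMType F) : HodgeConjectureFor (cmProdAV F h₃ n Θ).dim (cmProdAV F h₃ n Θ).X :=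
  (universeOf_hc_cmProd_iff_hodgeConjectureFor_cmProdAV hHD hI hU h₃ (CMField.mk F) n Θ).1
    (hc_cmProd_of_weilFaceAlgebraic_of_riemann hHD hI hU h₃ (CMField.mk F) deligneMilne1982_Thm_6_20_full_holds hG h6
      hfaces Θ)

/-- **Conversely**: the slice at `F` makes every face Weil line of `F` algebraic (the Weil line consists of Hodge classes,
`Model.universeOf_fact_weilLine_hodge`, on `P(f) = U.cmProd ⟨F⟩ f.corner`). [cite: Deligne1982HodgeCycles, §4–§5] -/
theorem weilFaceAlgebraic_of_forall_cmProdAV (hHD : exists_isReal_hodgeModel) (hI : hodgePQ_independent_of_hodgeModel)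
    (hU : BallQuotientUniformisedDatum) (h₃ : CMAbelianVarietyRealised)
    (h : ∀ (n : ℕ) (Θ : Fin (n + 1) → CMType F), HodgeConjectureFor (cmProdAV F h₃ n Θ).dim (cmProdAV F h₃ n Θ).X)
    (f : Face F) : (universeOf hHD hI hU h₃).WeilFaceAlgebraic (CMField.mk F) f :=
  CyclotomicSlice.weilFaceAlgebraic_of_hc _ (universeOf_fact_weilLine_hodge hHD hI hU h₃) (CMField.mk F) f
    ((universeOf_hc_cmProd_iff_hodgeConjectureFor_cmProdAV hHD hI hU h₃ (CMField.mk F) 3 f.corner).2 (h 3 f.corner))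

/-- **The slice at a Galois CM field `F` of degree `≥ 6` ⟺ its face Weil lines are algebraic** (in any instance of the model
universe). [cite: Pohlmann1968, Thm. 1] [cite: Milne2020HodgeClassesAV, Theorem 1] -/
theorem forall_cmProdAV_iff_forall_weilFaceAlgebraic (hHD : exists_isReal_hodgeModel)
    (hI : hodgePQ_independent_of_hodgeModel) (hU : BallQuotientUniformisedDatum) (h₃ : CMAbelianVarietyRealised)
    (hG : IsGalois ℚ F) (h6 : 6 ≤ Module.finrank ℚ F) :
    (∀ (n : ℕ) (Θ : Fin (n + 1) → CMType F), HodgeConjectureFor (cmProdAV F h₃ n Θ).dim (cmProdAV F h₃ n Θ).X) ↔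
      ∀ f : Face F, (universeOf hHD hI hU h₃).WeilFaceAlgebraic (CMField.mk F) f :=
  ⟨weilFaceAlgebraic_of_forall_cmProdAV hHD hI hU h₃, forall_cmProdAV_of_forall_weilFaceAlgebraic hHD hI hU h₃ hG h6⟩

/-! ## §2 The slice at `F` ⟺ codimension two on the four-realisation products over `F` -/

/-- **Codimension-two HC on `∏_i A_{(F, f.corner i)}` gives the face statement `U.WeilFaceAlgebraic ⟨F⟩ f`** (per-degree
comparison `universeOf_hodgeClassesOf_le_alg_of_forall` and `Model.universeOf_fact_weilLine_hodge`).
[cite: Deligne1982HodgeCycles, §4–§5] [cite: Milne1999, §7 p. 72] -/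
theorem weilFaceAlgebraic_of_codimTwo_cmProdAV (hHD : exists_isReal_hodgeModel) (hI : hodgePQ_independent_of_hodgeModel)
    (hU : BallQuotientUniformisedDatum) (h₃ : CMAbelianVarietyRealised) (f : Face F)
    (h2 : ∀ c : complexBetti (cmProdAV F h₃ 3 f.corner).X (2 * 2), IsRationalClass c →
      IsOfHodgeType (cmProdAV F h₃ 3 f.corner).dim (cmProdAV F h₃ 3 f.corner).X (2 * 2) 2 2 c →
        c ∈ algebraicClasses (cmProdAV F h₃ 3 f.corner).X 2) :
    (universeOf hHD hI hU h₃).WeilFaceAlgebraic (CMField.mk F) f := by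
  refine (universeOf_fact_weilLine_hodge hHD hI hU h₃ (CMField.mk F) f).trans ?_
  rw [CyclotomicSlice.prod4_eq_cmProd]
  refine universeOf_hodgeClassesOf_le_alg_of_forall hHD hI hU h₃ _ 2 ?_
  have hX : PicardCM.Var.scheme hU h₃ ((universeOf hHD hI hU h₃).cmProd (CMField.mk F) f.corner) =
      (cmProdAV F h₃ 3 f.corner).X :=
    scheme_cmProd_universeOf hHD hI hU h₃ (CMField.mk F) 3 f.corner
  have hdim : (cmProdAV F h₃ 3 f.corner).dim =
      PicardCM.Var.dim ((universeOf hHD hI hU h₃).cmProd (CMField.mk F) f.corner) := by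
    rw [AbelianVariety.dim, ← hX]
    exact schemeDim_eq_holds (PicardCM.Var.isSmoothProjective hU h₃ _)
  rw [hX, ← hdim]
  exact h2

/-- **The slice at a Galois CM field `F` of degree `≥ 6` ⟺ the rational `(2,2)`-classes on every `∏_{j<4} A_{(F,Θ_j)}` are
algebraic** (the model universe is used only in the proof, at its instance of record).
[cite: Pohlmann1968, Thm. 1] [cite: Andre1992HodgeCM, Théorème (pp. 4–5)] [cite: Milne2020HodgeClassesAV, Theorem 1] -/
theorem forall_cmProdAV_iff_codimTwo_cmProdAV_three (h₃ : CMAbelianVarietyRealised) (hG : IsGalois ℚ F)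
    (h6 : 6 ≤ Module.finrank ℚ F) :
    (∀ (n : ℕ) (Θ : Fin (n + 1) → CMType F), HodgeConjectureFor (cmProdAV F h₃ n Θ).dim (cmProdAV F h₃ n Θ).X) ↔
      ∀ (Θ : Fin 4 → CMType F) (c : complexBetti (cmProdAV F h₃ 3 Θ).X (2 * 2)), IsRationalClass c →
        IsOfHodgeType (cmProdAV F h₃ 3 Θ).dim (cmProdAV F h₃ 3 Θ).X (2 * 2) 2 2 c → c ∈ algebraicClasses (cmProdAV F h₃ 3 Θ).X 2 :=
  ⟨fun h Θ c hcQ hcH => (h 3 Θ).2 2 c hcQ hcH, fun h =>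
    forall_cmProdAV_of_forall_weilFaceAlgebraic exists_isReal_hodgeModel_holds hodgePQ_independent_of_hodgeModel_holds
      (ballQuotientUniformisedDatum_of BallQuotient.ballQuotientUniformised_holds) h₃ hG h6 fun f =>
      weilFaceAlgebraic_of_codimTwo_cmProdAV _ _ _ h₃ f (h f.corner)⟩

/-- **The slice at `F` ⟺ the rational `(2,2)`-classes on `P_F⁴ = (∏_i A_{(F,Θ₀ i)})⁴` are algebraic**, for `Θ₀` meeting
every `(Aut F × {1, bar})`-orbit of CM types — ONE abelian variety, ONE codimension (part 5's descent
`codimTwo_cmProdAV_three_of_powSucc_three`; part 1's `exists_avDominatedBy_powSucc_cmProdAV` for ⟹).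
[cite: Pohlmann1968, Thm. 1] [cite: MumfordAV1970, §19 Thm. 1 and Remark p. 169] -/
theorem forall_cmProdAV_iff_codimTwo_powSucc_three (h₃ : CMAbelianVarietyRealised) (hG : IsGalois ℚ F)
    (h6 : 6 ≤ Module.finrank ℚ F) {N : ℕ} {Θ₀ : Fin (N + 1) → CMType F}
    (hΘ₀ : ∀ Φ : CMType F, ∃ (i : Fin (N + 1)) (e : F ≃+* F),
      Θ₀ i = cmTypeMap e Φ ∨ Θ₀ i = cmTypeMap e (bar Φ)) :
    (∀ (n : ℕ) (Θ : Fin (n + 1) → CMType F), HodgeConjectureFor (cmProdAV F h₃ n Θ).dim (cmProdAV F h₃ n Θ).X) ↔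
      ∀ c : complexBetti ((cmProdAV F h₃ N Θ₀).powSucc 3).X (2 * 2), IsRationalClass c →
        IsOfHodgeType ((cmProdAV F h₃ N Θ₀).powSucc 3).dim ((cmProdAV F h₃ N Θ₀).powSucc 3).X (2 * 2) 2 2 c →
          c ∈ algebraicClasses ((cmProdAV F h₃ N Θ₀).powSucc 3).X 2 := by
  refine ⟨fun h c hcQ hcH => ?_, fun h => (forall_cmProdAV_iff_codimTwo_cmProdAV_three h₃ hG h6).2
    (codimTwo_cmProdAV_three_of_powSucc_three h₃ hΘ₀ h)⟩
  obtain ⟨n, Θ, hdom⟩ := exists_avDominatedBy_powSucc_cmProdAV h₃ Θ₀ 3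
  exact (hodgeConjectureFor_of_avDominatedBy (h n Θ) hdom).2 2 c hcQ hcH

/-- **The same for a surjective enumeration `Θ₀` of `CMType F`.** [cite: Pohlmann1968, Thm. 1] [cite: MumfordAV1970, §19] -/
theorem forall_cmProdAV_iff_codimTwo_powSucc_three_of_surjective (h₃ : CMAbelianVarietyRealised) (hG : IsGalois ℚ F)
    (h6 : 6 ≤ Module.finrank ℚ F) {N : ℕ} {Θ₀ : Fin (N + 1) → CMType F} (hΘ₀ : Function.Surjective Θ₀) :
    (∀ (n : ℕ) (Θ : Fin (n + 1) → CMType F), HodgeConjectureFor (cmProdAV F h₃ n Θ).dim (cmProdAV F h₃ n Θ).X) ↔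
      ∀ c : complexBetti ((cmProdAV F h₃ N Θ₀).powSucc 3).X (2 * 2), IsRationalClass c →
        IsOfHodgeType ((cmProdAV F h₃ N Θ₀).powSucc 3).dim ((cmProdAV F h₃ N Θ₀).powSucc 3).X (2 * 2) 2 2 c →
          c ∈ algebraicClasses ((cmProdAV F h₃ N Θ₀).powSucc 3).X 2 :=
  forall_cmProdAV_iff_codimTwo_powSucc_three h₃ hG h6 (meets_of_surjective hΘ₀)

/-! ## §3 The binder-language slice at `F` is decided in codimension two -/

/-- **The `CMAbelianHodge`-binder slice at a Galois CM field `F` of degree `≥ 6` ⟺ the rational `(2,2)`-classes on every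
`∏_{j<4} A_{(F,Θ_j)}` are algebraic** (part 2 `binderSlice_iff_forall_cmProdAV`, then §2). [cite: Pohlmann1968, Thm. 1]
[cite: Andre1992HodgeCM, Théorème (pp. 4–5)] [cite: Milne2020HodgeClassesAV, Theorem 1] -/
theorem binderSlice_iff_codimTwo_cmProdAV_three (hG : IsGalois ℚ F) (h6 : 6 ≤ Module.finrank ℚ F) :
    (∀ A : AbelianVariety ℂ, IsSmoothProjective A.dim A.X →
      (∃ S : Subalgebra ℚ A.endAlgebra,
        IsReduced ↥S ∧ (∀ x ∈ S, ∀ y ∈ S, x * y = y * x) ∧ Module.finrank ℚ ↥S = 2 * A.dim) →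
      (∀ (B : AbelianVariety ℂ) (f : B ⟶ A), IsClosedImmersion (AbelianVariety.Hom.toSchemeHom f) →
        AbelianVariety.IsSimple B → 0 < B.dim → Nonempty (B.endAlgebra →+* F)) →
      HodgeConjectureFor A.dim A.X) ↔
    ∀ (Θ : Fin 4 → CMType F) (c : complexBetti (cmProdAV F cmAbelianVarietyRealised_holds 3 Θ).X (2 * 2)),
      IsRationalClass c →
      IsOfHodgeType (cmProdAV F cmAbelianVarietyRealised_holds 3 Θ).dim (cmProdAV F cmAbelianVarietyRealised_holds 3 Θ).X
        (2 * 2) 2 2 c → c ∈ algebraicClasses (cmProdAV F cmAbelianVarietyRealised_holds 3 Θ).X 2 :=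
  binderSlice_iff_forall_cmProdAV.trans (forall_cmProdAV_iff_codimTwo_cmProdAV_three cmAbelianVarietyRealised_holds hG h6)

end Summit.HodgeConjecture.CorCM.SliceExhaustion

end
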